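import Literature.Probability.RandomPlanarGeometry.SLETraceEight
import Literature.Analysis.Complex.Montel
import Literature.Analysis.Complex.Hurwitz
import HarnessLib

/-!
# Lawler–Schramm–Werner (2004), Lemma 3.14 (ii) PROVED: the Carathéodory kernel step

Trunk T-STOCH, tenure file of the named fact `Literature.Probability.RandomPlanarGeometry.hasSLETrace_eight`
(SLE₈ is generated by a curve = [LSW04] Thm. 4.7). The decomposition of its printed proof
(`SLETraceEight.lean`) isolates two deterministic statements, the chordal analogue of
Lemma 3.14 (Convergence relations), p. 967 ("valid with the same proof", p. 981):

* (i) `Wₙ → W` locally uniformly ⇒ `fₜⁿ → fₜ` locally uniformly on `[0, ∞) × ℍ`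
  (`LawlerSchrammWerner2004_lemma314_maps`, proved in `SLETraceEight.lean`);
* (ii) if moreover `fₜⁿ(ℍ)` is the unbounded component of `ℍ ∖ γₙ[0, t]` for continuous curves
  `γₙ → γ` locally uniformly, then `fₜ(ℍ)` is the unbounded component of `ℍ ∖ γ[0, t]`
  (`LawlerSchrammWerner2004_lemma314_kernel`; printed proof: "a consequence of the Carathéodory
  kernel theorem", Pommerenke (1992) Thm. 1.8).

This file **discharges (ii)**: `Literature.Probability.RandomPlanarGeometry.LawlerSchrammWerner2004_lemma314_kernel_holds`.
Consequently the limit step of the proof of Thm. 4.7 (p. 981),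
`Loewner.isGeneratedByCurve_of_tendstoLocallyUniformly`, becomes unconditional
(`Loewner.isGeneratedByCurve_of_tendstoLocallyUniformly'`).

## Proof (the kernel theorem, run for this configuration)

Write `Hₜ = fₜ(ℍ)`, `Hₜⁿ = fₜⁿ(ℍ) = 𝒰(γₙ[0,t])` and `𝒰(S)` for the unbounded component of `ℍ ∖ S`.

* `Hₜ ⊆ 𝒰(γ[0,t])` (`Loewner.image_loewnerInv_subset_unboundedComponent_of_tendsto`). `Hₜ` is
  connected and unbounded, so it suffices that it misses `γ[0, t]`. If `fₜ(ζ) = γ(s)`, Hurwitz's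
  theorem (`Complex.eventually_exists_zero_mem_ball_of_tendstoUniformlyOn`, i.e. Rouché on a small
  circle about `ζ`, where `fₜ - γ(s)` has no zero by injectivity) applied to
  `fₜⁿ - γₙ(s) → fₜ - γ(s)` produces, for large `n`, a point `z ∈ ℍ` with `fₜⁿ(z) = γₙ(s)`,
  contradicting `Hₜⁿ ∩ γₙ[0, t] = ∅`.
* `𝒰(γ[0,t]) ⊆ Hₜ` (`Loewner.unboundedComponent_subset_image_loewnerInv_of_tendsto`). Fix
  `w ∈ 𝒰(γ[0,t])` and a far point `z₁ = iY`. Join them by a path in the open connected set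
  `𝒰(γ[0,t])`; a thin open neighbourhood `Δ` of the path (a thickening, connected) has compact
  closure in `𝒰(γ[0,t])`, hence lies in `ℍ ∖ γₙ[0,t]` for large `n` (uniform convergence on
  `[0, t]`), hence in `Hₜⁿ` (it is connected and contains `z₁ ∈ 𝒰(γₙ[0,t])`). The maps
  `C ∘ gₜⁿ`, `C` the Cayley transform, are holomorphic on `Δ` and bounded by `1`; by Montel
  (`Complex.exists_strictMono_tendstoLocallyUniformlyOn_of_norm_le`) a subsequence converges
  locally uniformly on `Δ` to a holomorphic `φ` with `|φ| ≤ 1`. At the far point,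
  `|gₜⁿ(z₁) - z₁| ≤ δ/2` uniformly in `n` (Lawler's Lemma 4.13, `Loewner.lt_swallowingTime_of_far`),
  so `|φ(z₁)| < 1`, and the maximum modulus principle on the connected open set `Δ`
  (`Complex.eqOn_of_isPreconnected_of_isMaxOn_norm`) gives `|φ(w)| < 1`. Thus
  `gₜⁿ(w) → ζ := C⁻¹(φ(w)) ∈ ℍ` along the subsequence, and by (i) and continuity of `fₜ`,
  `w = fₜⁿ(gₜⁿ(w)) → fₜ(ζ)`, i.e. `w = fₜ(ζ) ∈ Hₜ`.

## References

* G. F. Lawler, O. Schramm, W. Werner, *Conformal invariance of planar loop-erased random walks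
  and uniform spanning trees*, Ann. Probab. 32 (2004) 939–995, Lemma 3.14 (p. 967) and proof of
  Thm. 4.7 (p. 981). [LawlerSchrammWerner2004]
* Ch. Pommerenke, *Boundary Behaviour of Conformal Maps*, Springer (1992), Thm. 1.8
  (Carathéodory kernel theorem). [PommerenkeBBCM1992]
* J. B. Conway, *Functions of One Complex Variable I* (1978), VII.2.5 (Hurwitz), VII.2.9 (Montel).
-/

noncomputable section

open Set Filter Topology Metric Complex
open UpperHalfPlane (upperHalfPlaneSet isOpen_upperHalfPlaneSet)
open scoped NNReal

namespace Literature.Probability.RandomPlanarGeometry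

namespace Loewner

variable {Wn : ℕ → ℝ≥0 → ℝ} {W : ℝ≥0 → ℝ} {γn : ℕ → ℝ≥0 → ℂ} {γ : ℝ≥0 → ℂ}

/-! ### Preliminaries: slices and subsequences of locally uniform limits -/

/-- Locally uniform convergence along `atTop` passes to subsequences (any `ψ → ∞`). [folklore] -/
theorem tendstoLocallyUniformlyOn_comp_of_tendsto_atTop {α β : Type*} [TopologicalSpace α]
    [UniformSpace β] {F : ℕ → α → β} {f : α → β} {s : Set α}
    (h : TendstoLocallyUniformlyOn F f atTop s) {ψ : ℕ → ℕ} (hψ : Tendsto ψ atTop atTop) :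
    TendstoLocallyUniformlyOn (fun k ↦ F (ψ k)) f atTop s := fun u hu x hx ↦ by
  obtain ⟨t, ht, hev⟩ := h u hu x hx
  exact ⟨t, ht, hψ.eventually hev⟩

/-- **Lemma 3.14 (i) at a fixed time**: if `Wₙ → W` locally uniformly then `fₜⁿ → fₜ` locally
uniformly on `ℍₒ` (the slice `{t} × ℍₒ` of `LawlerSchrammWerner2004_lemma314_maps_holds`).
[cite: LawlerSchrammWerner2004, Lemma 3.14] -/
theorem tendstoLocallyUniformlyOn_loewnerInv (hWn : ∀ n, Continuous (Wn n)) (hW : Continuous W)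
    (hlim : TendstoLocallyUniformly Wn W atTop) (t : ℝ≥0) :
    TendstoLocallyUniformlyOn (fun n ↦ loewnerInv (Wn n) t) (loewnerInv W t) atTop
      upperHalfPlaneSet := by
  have h := LawlerSchrammWerner2004_lemma314_maps_holds hWn hW hlim
  exact h.comp (fun z : ℂ ↦ ((t, z) : ℝ≥0 × ℂ)) (fun z hz ↦ ⟨mem_univ _, hz⟩)
    (continuous_const.prodMk continuous_id).continuousOn

/-- Uniform convergence of the curves on `[0, t]`: eventually `dist (γ s) (γₙ s) < ε` for all
`s ≤ t`. [folklore] -/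
theorem eventually_forall_dist_lt_of_tendstoLocallyUniformly
    (hγlim : TendstoLocallyUniformly γn γ atTop) (t : ℝ≥0) {ε : ℝ} (hε : 0 < ε) :
    ∀ᶠ n in atTop, ∀ s ∈ Icc 0 t, dist (γ s) (γn n s) < ε :=
  Metric.tendstoUniformlyOn_iff.1
    ((tendstoLocallyUniformly_iff_forall_isCompact.1 hγlim) _ isCompact_Icc) ε hε

/-! ### `Hₜ ⊆ 𝒰(γ[0,t])`: Hurwitz -/

/-- **`fₜ(ℍₒ)` misses the limit curve.** If `Wₙ → W` locally uniformly, each `fₜⁿ(ℍₒ)` misses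
`γₙ[0, t]`, and `γₙ(s) → γ(s)` for `s ≤ t`, then `fₜ(ζ) ∉ γ[0, t]` for every `ζ ∈ ℍₒ`: otherwise
`fₜ(ζ) = γ(s)` and Hurwitz's theorem for `fₜⁿ - γₙ(s) → fₜ - γ(s)` on a small disc about `ζ`
(zero-free on the boundary circle by injectivity of `fₜ`) yields `fₜⁿ(z) = γₙ(s)` for some
`z ∈ ℍₒ` and large `n`. [cite: LawlerSchrammWerner2004, Lemma 3.14] -/
theorem loewnerInv_notMem_image_of_tendsto (hWn : ∀ n, Continuous (Wn n)) (hW : Continuous W)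
    (hWlim : TendstoLocallyUniformly Wn W atTop) {t : ℝ≥0}
    (hmiss : ∀ n, loewnerInv (Wn n) t '' upperHalfPlaneSet ⊆ (γn n '' Icc 0 t)ᶜ)
    (hγpt : ∀ s ∈ Icc 0 t, Tendsto (fun n ↦ γn n s) atTop (𝓝 (γ s)))
    {ζ : ℂ} (hζ : 0 < ζ.im) : loewnerInv W t ζ ∉ γ '' Icc 0 t := by
  rintro ⟨s, hs, hγs⟩
  -- a closed disc about `ζ` inside `ℍₒ`
  set r : ℝ := ζ.im / 2 with hr
  have hr0 : 0 < r := by positivity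
  have hball : closedBall ζ r ⊆ upperHalfPlaneSet := fun z hz ↦ by
    have h1 : |z.im - ζ.im| ≤ r := (abs_im_le_norm (z - ζ)).trans (by
      simpa [dist_eq_norm, sub_im] using (mem_closedBall.1 hz))
    change 0 < z.im
    have := (abs_le.1 h1).1
    linarith
  -- uniform convergence `fₜⁿ - γₙ(s) → fₜ - γ(s)` on the closed disc
  have hloc := tendstoLocallyUniformlyOn_loewnerInv hWn hW hWlim t
  have hunif : TendstoUniformlyOn (fun n ↦ loewnerInv (Wn n) t) (loewnerInv W t) atTop
      (closedBall ζ r) :=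
    (tendstoLocallyUniformlyOn_iff_forall_isCompact isOpen_upperHalfPlaneSet).1 hloc _ hball
      (isCompact_closedBall _ _)
  have hunif' : TendstoUniformlyOn (fun n z ↦ loewnerInv (Wn n) t z - γn n s)
      (fun z ↦ loewnerInv W t z - γ s) atTop (closedBall ζ r) :=
    hunif.sub ((hγpt s hs).tendstoUniformlyOn_const (closedBall ζ r))
  have hF : ∀ᶠ n in atTop, DiffContOnCl ℂ (fun z ↦ loewnerInv (Wn n) t z - γn n s) (ball ζ r) :=
    Eventually.of_forall fun n ↦
      ((differentiableOn_invFunOn_map (hWn n) t).sub_const _).diffContOnCl_ball hball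
  have hfc : ContinuousOn (fun z ↦ loewnerInv W t z - γ s) (sphere ζ r) :=
    ((differentiableOn_invFunOn_map hW t).continuousOn.mono
      (sphere_subset_closedBall.trans hball)).sub continuousOn_const
  have hf0 : loewnerInv W t ζ - γ s = 0 := by rw [hγs, sub_self]
  have hsphere : ∀ z ∈ sphere ζ r, loewnerInv W t z - γ s ≠ 0 := by
    intro z hz h0
    have hzζ : z ≠ ζ := by
      intro h
      rw [h, mem_sphere, dist_self] at hz
      exact hr0.ne hz
    have heq : loewnerInv W t z = loewnerInv W t ζ := by
      rw [sub_eq_zero] at h0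
      rw [h0, hγs]
    exact hzζ ((bijOn_invFunOn_map hW t).injOn (hball (sphere_subset_closedBall hz)) hζ heq)
  obtain ⟨n, z, hz, hzero⟩ :=
    (eventually_exists_zero_mem_ball_of_tendstoUniformlyOn hr0 hF hunif' hfc hf0 hsphere).exists
  have hzH : z ∈ upperHalfPlaneSet := hball (ball_subset_closedBall hz)
  rw [sub_eq_zero] at hzero
  exact hmiss n ⟨z, hzH, hzero⟩ ⟨s, hs, rfl⟩

/-- **`Hₜ = fₜ(ℍₒ)` lies in the unbounded component of `ℍₒ ∖ γ[0, t]`** under the hypotheses of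
Lemma 3.14 (ii): `Hₜ` is connected (`isPreconnected_domain`), unbounded (`not_isBounded_domain`)
and misses `γ[0, t]` (`loewnerInv_notMem_image_of_tendsto`).
[cite: LawlerSchrammWerner2004, Lemma 3.14] -/
theorem image_loewnerInv_subset_unboundedComponent_of_tendsto (hWn : ∀ n, Continuous (Wn n))
    (hW : Continuous W) (hWlim : TendstoLocallyUniformly Wn W atTop) {t : ℝ≥0}
    (hmiss : ∀ n, loewnerInv (Wn n) t '' upperHalfPlaneSet ⊆ (γn n '' Icc 0 t)ᶜ)
    (hγpt : ∀ s ∈ Icc 0 t, Tendsto (fun n ↦ γn n s) atTop (𝓝 (γ s))) :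
    loewnerInv W t '' upperHalfPlaneSet ⊆
      unboundedComponent (upperHalfPlaneSet \ γ '' Icc 0 t) := by
  rw [image_loewnerInv hW t]
  refine subset_unboundedComponent_of_isPreconnected (isPreconnected_domain hW t)
    (fun w hw ↦ ⟨domain_subset W t hw, ?_⟩) (not_isBounded_domain hW t)
  have h := loewnerInv_notMem_image_of_tendsto hWn hW hWlim hmiss hγpt (im_map_pos hW hw)
  rwa [loewnerInv_map hW hw] at h


/-! ### `𝒰(γ[0,t]) ⊆ Hₜ`: Montel -/

/-- A preconnected subset of `F` meeting the union of the unbounded components of `F` lies in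
it. [folklore] -/
theorem subset_unboundedComponent_of_mem {F T : Set ℂ} (hT : IsPreconnected T) (hTF : T ⊆ F)
    {z₁ : ℂ} (hz₁ : z₁ ∈ T) (hz₁U : z₁ ∈ unboundedComponent F) : T ⊆ unboundedComponent F := by
  intro z hz
  refine ⟨hTF hz, fun hb ↦ hz₁U.2 ?_⟩
  rw [← connectedComponentIn_eq (hT.subset_connectedComponentIn hz hTF hz₁)]
  exact hb

/-- An open thickening of a preconnected set is preconnected (every point is joined to the set
by a ball centred on it). [folklore] -/
theorem isPreconnected_thickening {K : Set ℂ} (hK : IsPreconnected K) {ε : ℝ} (hε : 0 < ε) :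
    IsPreconnected (thickening ε K) := by
  rcases K.eq_empty_or_nonempty with rfl | ⟨w, hw⟩
  · rw [thickening_empty]
    exact isPreconnected_empty
  refine isPreconnected_of_forall w fun y hy ↦ ?_
  obtain ⟨z, hz, hyz⟩ := mem_thickening_iff.1 hy
  refine ⟨ball z ε ∪ K, union_subset (fun x hx ↦ mem_thickening_iff.2 ⟨z, hz, hx⟩)
    (self_subset_thickening hε K), Or.inr hw, Or.inl hyz, ?_⟩
  exact (convex_ball z ε).isPreconnected.union z (mem_ball_self hε) hz hK

/-- Points of a closed disc of radius `r` about `c` have imaginary part `≥ im c - r`. [folklore] -/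
theorem im_sub_le_im_of_mem_closedBall {c z : ℂ} {r : ℝ} (hz : z ∈ closedBall c r) :
    c.im - r ≤ z.im := by
  have h1 : |z.im - c.im| ≤ r :=
    (abs_im_le_norm (z - c)).trans (by simpa [dist_eq_norm] using mem_closedBall.1 hz)
  linarith [(abs_le.1 (by simpa [sub_im] using h1 : |z.im - c.im| ≤ r)).1]

/-- **The unbounded component of `ℍₒ ∖ γ[0, t]` lies in `Hₜ = fₜ(ℍₒ)`** under the hypotheses of
Lemma 3.14 (ii) — the Carathéodory-kernel half, by Montel's theorem for the bounded holomorphic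
maps `C ∘ gₜⁿ` (`C` the Cayley transform) on a thin connected open neighbourhood `Δ` of a path from
the given point `w` to a far point `z₁`, the far-field estimate `|gₜⁿ(z₁) - z₁| ≤ δ/2`
(`lt_swallowingTime_of_far`) anchoring the limit inside the disc, the maximum modulus principle,
and Lemma 3.14 (i). See the module docstring. [cite: LawlerSchrammWerner2004, Lemma 3.14] -/
theorem unboundedComponent_subset_image_loewnerInv_of_tendsto (hWn : ∀ n, Continuous (Wn n))
    (hW : Continuous W) (hWlim : TendstoLocallyUniformly Wn W atTop) {t : ℝ≥0}
    (hγn : ∀ n, Continuous (γn n))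
    (hdom : ∀ n, domain (Wn n) t = unboundedComponent (upperHalfPlaneSet \ γn n '' Icc 0 t))
    (hγlim : TendstoLocallyUniformly γn γ atTop) :
    unboundedComponent (upperHalfPlaneSet \ γ '' Icc 0 t) ⊆ loewnerInv W t '' upperHalfPlaneSet := by
  intro w hwU
  have hγc : Continuous γ := hγlim.continuous (Frequently.of_forall hγn)
  set S : Set ℂ := γ '' Icc 0 t with hS
  have hSc : IsCompact S := isCompact_Icc.image hγc
  obtain ⟨R₀, hR₀⟩ := hSc.isBounded.subset_closedBall 0
  have hUo : IsOpen (unboundedComponent (upperHalfPlaneSet \ S)) :=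
    isOpen_unboundedComponent hSc.isClosed hSc.isBounded
  have hUc : IsConnected (unboundedComponent (upperHalfPlaneSet \ S)) :=
    isConnected_unboundedComponent hSc.isBounded
  -- a uniform bound for the driving functions on `[0, t]`
  obtain ⟨M, hM0, hM⟩ := exists_forall_norm_driving_sub_le hW t 0
  have hWunif : ∀ᶠ n in atTop, ∀ u ∈ Icc 0 t, dist (W u) (Wn n u) < 1 :=
    Metric.tendstoUniformlyOn_iff.1
      ((tendstoLocallyUniformly_iff_forall_isCompact.1 hWlim) _ isCompact_Icc) 1 one_pos
  have hMn : ∀ᶠ n in atTop, ∀ u ∈ Icc (0 : ℝ) t, ‖(Wn n u.toNNReal : ℂ) - 0‖ ≤ M + 1 := by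
    filter_upwards [hWunif] with n hn u hu
    have h1 := hM u hu
    have hu' : u.toNNReal ∈ Icc (0 : ℝ≥0) t := ⟨bot_le, Real.toNNReal_le_iff_le_coe.2 hu.2⟩
    have h2 := hn _ hu'
    rw [sub_zero, Complex.norm_real, Real.norm_eq_abs] at h1 ⊢
    rw [Real.dist_eq, abs_sub_comm] at h2
    linarith [abs_sub_abs_le_abs_sub (Wn n u.toNNReal) (W u.toNNReal)]
  -- the radius `δ` with `4t ≤ δ²`
  set δ : ℝ := 2 * Real.sqrt t + 1 with hδ
  have hδ0 : 0 < δ := by positivity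
  have hδt : 4 * (t : ℝ) ≤ δ ^ 2 := by
    have h1 : Real.sqrt t ^ 2 = t := Real.sq_sqrt t.coe_nonneg
    nlinarith [Real.sqrt_nonneg (t : ℝ)]
  -- the far point `z₁ = iY`
  set Y : ℝ := max (|R₀| + 2) (M + 1 + 2 * δ) with hY
  have hY1 : |R₀| + 2 ≤ Y := le_max_left _ _
  have hY2 : M + 1 + 2 * δ ≤ Y := le_max_right _ _
  have hY0 : 0 < Y := lt_of_lt_of_le (by positivity) hY1
  set z₁ : ℂ := I * Y with hz₁
  have hz₁im : z₁.im = Y := by simp [hz₁]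
  have hz₁H : z₁ ∈ upperHalfPlaneSet := by
    change 0 < z₁.im
    rwa [hz₁im]
  have hz₁n : ‖z₁‖ = Y := by
    rw [hz₁, norm_mul, norm_I, one_mul, Complex.norm_real, Real.norm_eq_abs, abs_of_pos hY0]
  have hz₁U : z₁ ∈ unboundedComponent (upperHalfPlaneSet \ S) :=
    mem_unboundedComponent_of_lt_norm hR₀ hz₁H (by rw [hz₁n]; linarith [le_abs_self R₀])
  -- a path from `w` to `z₁` in the open connected set `𝒰(γ[0,t])`, and its compact range `K`
  obtain ⟨p, hp⟩ : JoinedIn (unboundedComponent (upperHalfPlaneSet \ S)) w z₁ :=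
    ((hUo.isConnected_iff_isPathConnected).1 hUc).joinedIn w hwU z₁ hz₁U
  set K : Set ℂ := range p with hK
  have hKc : IsCompact K := isCompact_range p.continuous
  have hKconn : IsPreconnected K := isPreconnected_range p.continuous
  have hKU : K ⊆ unboundedComponent (upperHalfPlaneSet \ S) := by
    rintro _ ⟨x, rfl⟩
    exact hp x
  have hwK : w ∈ K := ⟨0, p.source⟩
  have hz₁K : z₁ ∈ K := ⟨1, p.target⟩
  -- a connected open thickening `Δ` of `K` whose double still lies in `𝒰(γ[0,t])`
  obtain ⟨ε2, hε2, hcth⟩ := hKc.exists_cthickening_subset_open hUo hKU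
  set ε : ℝ := ε2 / 2 with hε
  have hε0 : 0 < ε := by positivity
  set Δ : Set ℂ := thickening ε K with hΔ
  have hΔo : IsOpen Δ := isOpen_thickening
  have hΔconn : IsPreconnected Δ := isPreconnected_thickening hKconn hε0
  have hΔU : Δ ⊆ unboundedComponent (upperHalfPlaneSet \ S) :=
    ((thickening_mono (by linarith) K).trans (thickening_subset_cthickening ε2 K)).trans hcth
  have hΔH : Δ ⊆ upperHalfPlaneSet := fun z hz ↦ (unboundedComponent_subset _ (hΔU hz)).1
  have hwΔ : w ∈ Δ := self_subset_thickening hε0 K hwK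
  have hz₁Δ : z₁ ∈ Δ := self_subset_thickening hε0 K hz₁K
  -- eventually `Δ ⊆ Hₜⁿ`
  have hγunif := eventually_forall_dist_lt_of_tendstoLocallyUniformly hγlim t (lt_min hε0 one_pos)
  have hΔdom : ∀ᶠ n in atTop, Δ ⊆ domain (Wn n) t := by
    filter_upwards [hγunif] with n hn
    rw [hdom n]
    have hSn : γn n '' Icc 0 t ⊆ closedBall 0 (|R₀| + 1) := by
      rintro _ ⟨s, hs, rfl⟩
      have h1 : ‖γ s‖ ≤ R₀ := by simpa using hR₀ ⟨s, hs, rfl⟩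
      have h2 : dist (γ s) (γn n s) < 1 := (hn s hs).trans_le (min_le_right _ _)
      rw [mem_closedBall_zero_iff]
      rw [dist_comm, dist_eq_norm] at h2
      linarith [norm_sub_norm_le (γn n s) (γ s), le_abs_self R₀]
    have hz₁Un : z₁ ∈ unboundedComponent (upperHalfPlaneSet \ γn n '' Icc 0 t) :=
      mem_unboundedComponent_of_lt_norm hSn hz₁H (by rw [hz₁n]; linarith)
    have hΔF : Δ ⊆ upperHalfPlaneSet \ γn n '' Icc 0 t := by
      intro y hy
      refine ⟨hΔH hy, ?_⟩
      rintro ⟨s, hs, rfl⟩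
      obtain ⟨k, hk, hyk⟩ := mem_thickening_iff.1 hy
      have h1 : dist (γ s) (γn n s) < ε := (hn s hs).trans_le (min_le_left _ _)
      have h2 : γ s ∈ thickening ε2 K := mem_thickening_iff.2 ⟨k, hk, by
        calc dist (γ s) k ≤ dist (γ s) (γn n s) + dist (γn n s) k := dist_triangle _ _ _
          _ < ε + ε := add_lt_add h1 hyk
          _ = ε2 := by rw [hε]; ring⟩
      exact (unboundedComponent_subset _ (hcth (thickening_subset_cthickening ε2 K h2))).2
        ⟨s, hs, rfl⟩
    exact subset_unboundedComponent_of_mem hΔconn hΔF hz₁Δ hz₁Un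
  -- the tail where `Δ ⊆ Hₜⁿ` and `|Wₙ| ≤ M + 1` on `[0, t]`
  obtain ⟨N, hN⟩ := eventually_atTop.1 (hΔdom.and hMn)
  -- Montel for the bounded holomorphic maps `C ∘ gₜⁿ` on `Δ`
  set F : ℕ → ℂ → ℂ := fun k z ↦ cayleyFun (map (Wn (k + N)) t z) with hFdef
  have hmapsH : ∀ k, MapsTo (map (Wn (k + N)) t) Δ upperHalfPlaneSet := fun k z hz ↦
    mapsTo_map (hWn _) t ((hN (k + N) (Nat.le_add_left N k)).1 hz)
  have hFd : ∀ k, DifferentiableOn ℂ (F k) Δ := fun k ↦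
    differentiableOn_cayleyFun.comp
      ((differentiableOn_map (hWn _) t).mono (hN (k + N) (Nat.le_add_left N k)).1)
      fun z hz ↦ add_I_ne_zero (le_of_lt (hmapsH k hz))
  have hFb : ∀ k, ∀ z ∈ Δ, ‖F k z‖ ≤ 1 := fun k z hz ↦
    norm_cayleyFun_le_one (le_of_lt (hmapsH k hz))
  obtain ⟨φ, σ, hσ, hφd, hφlim, -⟩ :=
    exists_strictMono_tendstoLocallyUniformlyOn_of_norm_le hΔo hFd hFb
  have hφle : ∀ z ∈ Δ, ‖φ z‖ ≤ 1 := fun z hz ↦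
    le_of_tendsto' (hφlim.tendsto_at hz).norm fun k ↦ hFb _ z hz
  -- the anchor: `gₜⁿ(z₁)` stays in the compact disc `closedBall z₁ (δ/2) ⊆ ℍₒ`, so `|φ z₁| < 1`
  have hfar : ∀ k, ‖map (Wn (k + N)) t z₁ - z₁‖ ≤ δ / 2 := fun k ↦ by
    have hz₁far : M + 1 + 2 * δ ≤ ‖z₁ - 0‖ := by rwa [sub_zero, hz₁n]
    refine (((lt_swallowingTime_of_far (hWn (k + N)) (hN (k + N) (Nat.le_add_left N k)).2 hδ0
      hδt hz₁far).2 t le_rfl).2).trans ?_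
    rw [div_mul_eq_mul_div, div_le_div_iff₀ hδ0 two_pos]
    nlinarith
  have hCH : closedBall z₁ (δ / 2) ⊆ upperHalfPlaneSet := fun z hz ↦ by
    change 0 < z.im
    have h1 := im_sub_le_im_of_mem_closedBall hz
    rw [hz₁im] at h1
    linarith
  obtain ⟨zs, hzs, hmax⟩ := (isCompact_closedBall z₁ (δ / 2)).exists_isMaxOn
    (nonempty_closedBall.2 (by positivity))
    ((continuousOn_cayleyFun.mono fun z hz ↦ add_I_ne_zero (le_of_lt (hCH hz))).norm)
  have hcs : ‖cayleyFun zs‖ < 1 :=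
    (norm_cayleyFun_lt_one_iff (add_I_ne_zero (le_of_lt (hCH hzs)))).2 (hCH hzs)
  have hφz₁ : ‖φ z₁‖ < 1 := by
    refine lt_of_le_of_lt (le_of_tendsto' (hφlim.tendsto_at hz₁Δ).norm fun k ↦ ?_) hcs
    exact hmax (mem_closedBall.2 (by rw [dist_eq_norm]; exact hfar (σ k)))
  -- maximum modulus on the connected open set `Δ`: `|φ w| < 1`
  have hφw : ‖φ w‖ < 1 := by
    by_contra hge
    have h1 : ‖φ w‖ = 1 := le_antisymm (hφle w hwΔ) (not_lt.1 hge)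
    have hmaxw : IsMaxOn (norm ∘ φ) Δ w := fun z hz ↦ by
      change ‖φ z‖ ≤ ‖φ w‖
      rw [h1]
      exact hφle z hz
    have heq := Complex.eqOn_of_isPreconnected_of_isMaxOn_norm hΔconn hΔo hφd hwΔ hmaxw hz₁Δ
    rw [Function.const_apply] at heq
    rw [heq, h1] at hφz₁
    exact lt_irrefl _ hφz₁
  -- `gₜⁿ(w) → ζ := C⁻¹(φ w) ∈ ℍₒ` along the subsequence
  set ζ : ℂ := cayleyInvFun (φ w) with hζ
  have hζH : 0 < ζ.im := cayleyInvFun_im_pos hφw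
  have hφw1 : φ w ≠ 1 := by
    intro h
    rw [h, norm_one] at hφw
    exact lt_irrefl _ hφw
  set g : ℕ → ℂ := fun k ↦ map (Wn (σ k + N)) t w with hg
  have hgH : ∀ k, g k ∈ upperHalfPlaneSet := fun k ↦ hmapsH (σ k) hwΔ
  have hglim : Tendsto g atTop (𝓝 ζ) := by
    have h1 : Tendsto (fun k ↦ cayleyFun (g k)) atTop (𝓝 (φ w)) := hφlim.tendsto_at hwΔ
    have h2 : ContinuousAt cayleyInvFun (φ w) :=
      differentiableOn_cayleyInvFun.continuousOn.continuousAt (isOpen_ne.mem_nhds hφw1)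
    refine (h2.tendsto.comp h1).congr fun k ↦ ?_
    exact cayleyInvFun_cayleyFun (add_I_ne_zero (le_of_lt (hgH k)))
  -- `w = fₜⁿ(gₜⁿ(w)) → fₜ(ζ)` by Lemma 3.14 (i) and continuity of `fₜ` at `ζ`
  have hwdom : ∀ k, w ∈ domain (Wn (σ k + N)) t := fun k ↦ (hN _ (Nat.le_add_left N _)).1 hwΔ
  have hflim : Tendsto (fun k ↦ loewnerInv (Wn (σ k + N)) t (g k)) atTop
      (𝓝 (loewnerInv W t ζ)) := by
    have hsub := tendstoLocallyUniformlyOn_comp_of_tendsto_atTop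
      (tendstoLocallyUniformlyOn_loewnerInv hWn hW hWlim t)
      (hσ.add_const N).tendsto_atTop
    refine hsub.tendsto_comp (continuousAt_loewnerInv hW t hζH).continuousWithinAt hζH ?_
    exact tendsto_nhdsWithin_iff.2 ⟨hglim, Eventually.of_forall hgH⟩
  have hconst : (fun k ↦ loewnerInv (Wn (σ k + N)) t (g k)) = fun _ ↦ w :=
    funext fun k ↦ loewnerInv_map (hWn _) (hwdom k)
  rw [hconst, tendsto_const_nhds_iff] at hflim
  exact ⟨ζ, hζH, hflim.symm⟩

end Loewner

/-! ### Lemma 3.14 (ii) and the unconditional limit step -/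

/-- **[LSW04] Lemma 3.14, second statement, PROVED** (chordal; the named fact
`LawlerSchrammWerner2004_lemma314_kernel` of `SLETraceEight.lean` holds): if continuous driving
functions `Wₙ → W` locally uniformly, `fₜⁿ(ℍₒ)` is the unbounded component of `ℍₒ ∖ γₙ[0, t]` for
continuous curves `γₙ` in `ℍ̄ₒ`, and `γₙ → γ` locally uniformly, then `fₜ(ℍₒ)` is the unbounded
component of `ℍₒ ∖ γ[0, t]` for every `t`. The two inclusions are
`Loewner.image_loewnerInv_subset_unboundedComponent_of_tendsto` (Hurwitz) and
`Loewner.unboundedComponent_subset_image_loewnerInv_of_tendsto` (Montel, the kernel theorem).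
[cite: LawlerSchrammWerner2004, Lemma 3.14] -/
theorem LawlerSchrammWerner2004_lemma314_kernel_holds : LawlerSchrammWerner2004_lemma314_kernel := by
  intro Wn W γn γ hWn hW hWlim hγn _hγnim hdomn _hγim hγlim t
  have hdom : ∀ n, Loewner.domain (Wn n) t =
      Loewner.unboundedComponent (upperHalfPlaneSet \ γn n '' Icc 0 t) := fun n ↦ by
    rw [← Loewner.image_loewnerInv (hWn n) t]
    exact hdomn n t
  refine Subset.antisymm ?_ ?_
  · exact Loewner.image_loewnerInv_subset_unboundedComponent_of_tendsto hWn hW hWlim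
      (fun n ↦ (hdomn n t).subset.trans
        ((Loewner.unboundedComponent_subset _).trans fun _ hz ↦ hz.2))
      fun s _ ↦ hγlim.tendstoLocallyUniformlyOn.tendsto_at (mem_univ s)
  · exact Loewner.unboundedComponent_subset_image_loewnerInv_of_tendsto hWn hW hWlim hγn hdom
      hγlim

/-- **The limit step of the proof of [LSW04] Thm. 4.7 (p. 981), unconditional**: if continuous
driving functions `Wₙ → W` and curves `γₙ → γ` converge locally uniformly, each chain `(Wₙ)` being
generated by `γₙ`, then the chain of `W` is generated by `γ`
(`Loewner.isGeneratedByCurve_of_tendstoLocallyUniformly` fed with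
`LawlerSchrammWerner2004_lemma314_kernel_holds`). [cite: LawlerSchrammWerner2004, proof of Thm. 4.7] -/
theorem Loewner.isGeneratedByCurve_of_tendstoLocallyUniformly'
    {Wn : ℕ → ℝ≥0 → ℝ} {W : ℝ≥0 → ℝ} {γn : ℕ → ℝ≥0 → ℂ} {γ : ℝ≥0 → ℂ}
    (hWn : ∀ n, Continuous (Wn n)) (hW : Continuous W) (hWlim : TendstoLocallyUniformly Wn W atTop)
    (hgen : ∀ n, Loewner.IsGeneratedByCurve (Wn n) (γn n))
    (hγlim : TendstoLocallyUniformly γn γ atTop) :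
    Loewner.IsGeneratedByCurve W γ :=
  Loewner.isGeneratedByCurve_of_tendstoLocallyUniformly LawlerSchrammWerner2004_lemma314_kernel_holds
    hWn hW hWlim hgen hγlim

end Literature.Probability.RandomPlanarGeometry
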